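import Summits.BirchSwinnertonDyer.BirchSwinnertonDyer.Theorems.SchneiderFreeAdditiveX3AnomalousTwistLocalHZero
import Summits.BirchSwinnertonDyer.BirchSwinnertonDyer.Theorems.EisensteinPrimesSplitMultIndexPlumbing
import HarnessLib

/-!
# Route `SchneiderFreeAdditiveX3` (K1 door), crux r3 `GordTwoBranchIMC` (stmt-BirchSwinnertonDyer-19177): (B) + (C) OF THE V21 INDEX
# ROAD FOR THE ANOMALOUS `(−3)`-TWIST — `λ(𝔛^{Sf}_nr(θsub)) + λ(𝔛^{Sf}_nr(θquot)) ≤ λ(𝔛^{Sf}(W_K)) + [θquot = 𝟙]` from the mid-level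
# index identity, orientation `(ω, 𝟙)`

Cell `bsd-schneider-ideate`, seat `bsd-schneider-door-c5` (prover, generation 31; assembly layer; `--supports` 19177, helper).
PARTITION: board row B6 ∩ X3 ∩ sst-twist, `r = 1` — the 1 725 ANOMALOUS pairs of the (G-ord, `e = 2`) half at `p = 3` (of 2 411).
bears_on: K1-door (items 18971/18972 retired → 19177 r3).  FILE 4 of the port of cell `bsd-eis`'s V21 INDEX ROAD (Keller–Yin
arXiv:2402.12781 Thm. 1.4.1 (iii)) to the door's ANOMALOUS TWIN `W = C • V^{(−3)}` (FINDING-door-c5-g28 §5b `stub_λW`) = the door analogue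
of x2-p2 g10's `EisensteinPrimesSplitMultIndexPlumbing` (itself x1-w8's `IndexPlumbingNrVsStrict*` with the good-anomalous local inputs
replaced):
* §1 `unitChar_quot_eq_one_of_mem_decomp_of_anomalousTwist`, `smul_charModule_quot_eq_of_mem_decomp_of_anomalousTwist` — `D_v̄` acts
  trivially on `(F/𝒪)(θquot)` («`θquot|_{G_v̄} = 𝟙`»), from FILE 3's `trivQuot_and_exists_inertia_smul_ne_of_exists_unitChar_ne_one`;
* §2 (B1) `lambdaInvariant_le_zpCorank_grSelmer_add_pow_quot_of_anomalousTwist(_of_forall)` — x1-w8's generic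
  `lambdaInvariant_le_zpCorank_grSelmer_add_pow` fed §1 and the anticyclotomic generator of `ker κ ⊓ D_v̄` modulo inertia; (B2) is x2's
  character-level `SplitMultIndexPlumbing.lambdaInvariant_eq_zpCorank_grSelmer_of_ramified_of_forall` BY NAME, its binder «`θsub` ramified
  at `v̄`» being FILE 3's orientation upgrade `exists_mem_inertia_unitChar_ne_one_of_exists_mem_decomp`;
* §3 `lambdaInvariant_add_le_of_mid_anomalousTwist` — the `λ`-inequality from the mid-level identity
  `zpCorank R(W_K[3^∞]) + ε = zpCorank R((F/𝒪)(θsub)) + zpCorank R((F/𝒪)(θquot)) + 3^c` (x1-w5's dictionary (C) + (B2) + (B1) + `omega`).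

Binders: `V/ℚ` globally minimal good ordinary at `p = 3` with `3 ∣ a₃(V) − 1`, `W = C • V^{(p*)}` globally minimal, `K` imaginary quadratic
with `3 = v v̄` (x1's convention), `κ` anticyclotomic, `(θsub, θquot)` a residual pair of `W_K[3]` with some `τ ∈ D_v̄`, `θsub(τ) ≠ 1`.

HONEST FRAMING: helper theorems only (no definition, no named fact, no `sorry`); UNCONDITIONAL; closes no stub; nothing analytic; the
mid-level identity `hmid` is a HYPOTHESIS here (content of FILE 5); no item closed; BSD proved for no curve; «closes rung: none».
References: Keller–Yin arXiv:2402.12781v2 Thm. 1.4.1 (iii), §1.4, Rem. 1.2.2 [KellerYin2024]; Greenberg LNM 1716 §1 p. 60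
[GreenbergLNM1716]; Greenberg 1989 §1 [Greenberg1989]; x1 `IndexPlumbingNrVsStrict*`, x2 `SplitMultIndexPlumbing` (templates).
-/

set_option autoImplicit false
-- the route's Theorems namespace repeats the summit name by design (D-0017 nested layout)
set_option linter.dupNamespace false

noncomputable section

open scoped Classical AddSubgroup

namespace Summit.BirchSwinnertonDyer.BirchSwinnertonDyer.Theorems.SchneiderFreeAdditiveX3.AnomalousTwistIndexPlumbing

open Function NumberField IsDedekindDomain Field WeierstrassCurve
  Literature.NumberTheory.EllipticCurves Literature.NumberTheory.EllipticCurves.GreenbergSelmer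
  Literature.NumberTheory.EllipticCurves.GreenbergVatsal2000 Literature.NumberTheory.GaloisRepresentations
  Literature.NumberTheory.EllipticCurves.KellerYin2024 Literature.NumberTheory.IwasawaTheory
  Literature.NumberTheory.EllipticCurves.Rank1Residual Literature.NumberTheory.EllipticCurves.Castella2018
  Summit.BirchSwinnertonDyer.Rank1Residual Summit.BirchSwinnertonDyer.Rank1Residual.X2.ResidualDevissageModules
  Summit.BirchSwinnertonDyer.BirchSwinnertonDyer.Theorems
  Summit.BirchSwinnertonDyer.BirchSwinnertonDyer.Theorems.IndexPlumbingNrVsStrict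
  Summit.BirchSwinnertonDyer.BirchSwinnertonDyer.Theorems.SchneiderFreeAdditiveX3.AnomalousTwistLocalHZero

/-! ## §1. Orientation `(ω, 𝟙)`: `D_v̄` acts trivially on `(F/𝒪)(θquot)` -/

section QuotTrivial

variable {V : WeierstrassCurve ℚ} [V.IsElliptic] [V.IsGloballyMinimal] (W : WeierstrassCurve ℚ) [W.IsElliptic] {p : ℕ} [hp : Fact p.Prime]
  (K : Type) [Field K] [NumberField K] (vbar : HeightOneSpectrum (𝓞 K))

/-- **`unitChar θquot g = 1` for every `g ∈ D_v̄`, anomalous `(−3)`-twist, orientation `(ω, 𝟙)`.** `V/ℚ` globally minimal good ordinary at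
`p = 3` with `3 ∣ a₃(V) − 1`, `W = C • V^{(p*)}`, `K` imaginary quadratic with `3 = v v̄`, `(θsub, θquot)` a residual pair of `W_K[3]`, and some
`τ ∈ D_v̄` with `θsub(τ) ≠ 1`: then `D_v̄` is trivial on `W_K[3]/Φ` (FILE 3), which embeds equivariantly in `(F/𝒪)(θquot)`; a `g` with
`unitChar θquot g ≠ 1` would fix only `0` there (`eq_zero_of_smul_eq_of_hom`). «`θquot|_{G_v̄} = 𝟙`».
[cite: KellerYin2024, Prop. 1.3.1 and §1.4 display (char to f) (arXiv:2402.12781v2 TeX L877, L1063–1087)] -/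
theorem unitChar_quot_eq_one_of_mem_decomp_of_anomalousTwist
    (hp3 : p = 3) (hV : GoodOrd V p) (ha : (p : ℤ) ∣ V.frobeniusTrace p - 1)
    (C : VariableChange ℚ) (hC : C • V.quadraticTwist ((-1 : ℚ) ^ (p / 2) * p) = W)
    (hK : IsImaginaryQuadratic K) {v : HeightOneSpectrum (𝓞 K)} (hpvK : ((p : ℕ) : 𝓞 K) ∈ v.asIdeal)
    (hvbar : ((p : ℕ) : 𝓞 K) ∈ vbar.asIdeal) (hne : vbar ≠ v)
    {θsub θquot : FramedGaloisRep K (padicCoeffIntegers (∅ : Set (PadicAlgCl p))) 1}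
    (hpair : IsResidualPairOver (W.baseChange K) p θsub θquot)
    (hram : ∃ τ ∈ decomp vbar, unitChar θsub τ ≠ 1)
    {g : absoluteGaloisGroup K} (hg : g ∈ decomp vbar) : unitChar θquot g = 1 := by
  have hpr : p.Prime := hp.out
  haveI hEK : (W.baseChange K).IsElliptic := inferInstanceAs (W.map (algebraMap ℚ K)).IsElliptic
  have hθsub : ∀ σ : absoluteGaloisGroup K, θsub σ ^ (p - 1) = 1 := fun σ ↦ (hpair.pow_sub_one σ).1
  have hθquot : ∀ σ : absoluteGaloisGroup K, θquot σ ^ (p - 1) = 1 := fun σ ↦ (hpair.pow_sub_one σ).2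
  obtain ⟨Φ, hSub, -, ⟨j₁, hj₁, hj₁inj, -⟩, ⟨j₃, hj₃, hj₃inj, -⟩⟩ :=
    ResidualPairStableLine.exists_stableLine_of_isResidualPairOver (W.baseChange K) hpair
  obtain ⟨hQuot, hquot, -⟩ := trivQuot_and_exists_inertia_smul_ne_of_exists_unitChar_ne_one W K vbar hp3 hV ha C hC hK hpvK hvbar
    hne θsub hθsub Φ hSub j₁ hj₁ hj₁inj hram
  -- `Φ.Quot` has a non-zero element (order `p`)
  haveI : Finite Φ.Quot := Nat.finite_of_card_ne_zero (by rw [hQuot]; exact hpr.ne_zero)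
  have hnt : Nontrivial Φ.Quot := by
    rw [← Finite.one_lt_card_iff_nontrivial, hQuot]
    exact hpr.one_lt
  obtain ⟨y₀, hy₀⟩ := exists_ne (0 : Φ.Quot)
  by_contra hne1
  exact hy₀ (CharResidualSelmerCount.eq_zero_of_smul_eq_of_hom θquot hθquot j₃ hj₃ hj₃inj hne1 (hquot g hg y₀))

/-- **`D_v̄` acts trivially on `(F/𝒪)(θquot)`**, anomalous `(−3)`-twist, orientation `(ω, 𝟙)` (same hypotheses): V21 step (8),
`A_1^{I_j} = A_1 = F/𝒪` with TRIVIAL action of `G_j`, whence `λ_nr(𝟙̃) = λ_str(𝟙̃) + s`. The `htriv` input of x1-w8's generic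
`lambdaInvariant_le_zpCorank_grSelmer_add_pow`. [cite: KellerYin2024, §1.4 (arXiv:2402.12781v2 TeX L1240–1260) and Rem. 1.2.2] -/
theorem smul_charModule_quot_eq_of_mem_decomp_of_anomalousTwist
    (hp3 : p = 3) (hV : GoodOrd V p) (ha : (p : ℤ) ∣ V.frobeniusTrace p - 1)
    (C : VariableChange ℚ) (hC : C • V.quadraticTwist ((-1 : ℚ) ^ (p / 2) * p) = W)
    (hK : IsImaginaryQuadratic K) {v : HeightOneSpectrum (𝓞 K)} (hpvK : ((p : ℕ) : 𝓞 K) ∈ v.asIdeal)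
    (hvbar : ((p : ℕ) : 𝓞 K) ∈ vbar.asIdeal) (hne : vbar ≠ v)
    {θsub θquot : FramedGaloisRep K (padicCoeffIntegers (∅ : Set (PadicAlgCl p))) 1}
    (hpair : IsResidualPairOver (W.baseChange K) p θsub θquot)
    (hram : ∃ τ ∈ decomp vbar, unitChar θsub τ ≠ 1)
    {g : absoluteGaloisGroup K} (hg : g ∈ decomp vbar) (x : charModule (∅ : Set (PadicAlgCl p)) θquot) : g • x = x := by
  obtain ⟨z, rfl⟩ := (charModuleEquiv θquot).symm.surjective x
  rw [CharResidualSelmerFinite.galois_smul_charModuleEquiv_symm,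
    unitChar_quot_eq_one_of_mem_decomp_of_anomalousTwist W K vbar hp3 hV ha C hC hK hpvK hvbar hne hpair hram hg, Units.val_one,
    one_smul]

/-- **`θsub` is RAMIFIED at `v̄`** from the residual pair alone (orientation upgrade of FILE 3 at the pair's stable line).
[cite: KellerYin2024, Prop. 1.3.1 (arXiv:2402.12781v2 TeX L877)] -/
theorem exists_mem_inertia_unitChar_ne_one_of_anomalousTwist
    (hp3 : p = 3) (hV : GoodOrd V p) (ha : (p : ℤ) ∣ V.frobeniusTrace p - 1)
    (C : VariableChange ℚ) (hC : C • V.quadraticTwist ((-1 : ℚ) ^ (p / 2) * p) = W)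
    (hK : IsImaginaryQuadratic K) {v : HeightOneSpectrum (𝓞 K)} (hpvK : ((p : ℕ) : 𝓞 K) ∈ v.asIdeal)
    (hvbar : ((p : ℕ) : 𝓞 K) ∈ vbar.asIdeal) (hne : vbar ≠ v)
    {θsub θquot : FramedGaloisRep K (padicCoeffIntegers (∅ : Set (PadicAlgCl p))) 1}
    (hpair : IsResidualPairOver (W.baseChange K) p θsub θquot)
    (hram : ∃ τ ∈ decomp vbar, unitChar θsub τ ≠ 1) :
    ∃ τ ∈ inertia vbar, unitChar θsub τ ≠ 1 := by
  haveI hEK : (W.baseChange K).IsElliptic := inferInstanceAs (W.map (algebraMap ℚ K)).IsElliptic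
  have hθsub : ∀ σ : absoluteGaloisGroup K, θsub σ ^ (p - 1) = 1 := fun σ ↦ (hpair.pow_sub_one σ).1
  obtain ⟨Φ, hSub, -, ⟨j₁, hj₁, hj₁inj, -⟩, -⟩ :=
    ResidualPairStableLine.exists_stableLine_of_isResidualPairOver (W.baseChange K) hpair
  exact exists_mem_inertia_unitChar_ne_one_of_exists_mem_decomp W K vbar hp3 hV ha C hC hK hpvK hvbar hne θsub hθsub Φ hSub j₁ hj₁
    hj₁inj hram

end QuotTrivial

/-! ## §2. (B1) for the anomalous twist: `λ(𝔛^{S₀}_nr(θquot)) ≤ corank_{ℤ_3} R((F/𝒪)(θquot)) + 3^c` -/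

section QuotBound

variable {V : WeierstrassCurve ℚ} [V.IsElliptic] [V.IsGloballyMinimal] (W : WeierstrassCurve ℚ) [W.IsElliptic] {p : ℕ} [hp : Fact p.Prime]
  {K : Type} [Field K] [NumberField K] (κ : ZpExtension K p)

/-- **(B1) for the anomalous `(−3)`-twist, orientation `(ω, 𝟙)`: KY §1.4 «nr versus strict at `v̄`» for `θquot`, `≤` direction.**
`λ(DSquot.X) ≤ zpCorank (grSelmer κ (charModule ∅ θquot) v̄ S₀) + p^c` for any dual datum `DSquot` of `H¹_{𝓕_nr^{S₀}}(K_∞, (F/𝒪)(θquot))`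
that is f.g. `Λ`-torsion with `μ = 0`, representatives `τ i` (`i < p^c`) controlling the strict condition above `v̄`; x1-w8's generic
`lambdaInvariant_le_zpCorank_grSelmer_add_pow` fed §1 and `exists_generator_kerSubgroup_inf_decomp_of_isAnticyclotomic`.
[cite: KellerYin2024, §1.4 (arXiv:2402.12781v2 TeX L1240–1260) and Rem. 1.2.2] [cite: Greenberg1989, §1 p. 98] -/
theorem lambdaInvariant_le_zpCorank_grSelmer_add_pow_quot_of_anomalousTwist
    (hp3 : p = 3) (hV : GoodOrd V p) (ha : (p : ℤ) ∣ V.frobeniusTrace p - 1)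
    (C : VariableChange ℚ) (hC : C • V.quadraticTwist ((-1 : ℚ) ^ (p / 2) * p) = W)
    (hK : IsImaginaryQuadratic K) {v vbar : HeightOneSpectrum (𝓞 K)} (hpvK : ((p : ℕ) : 𝓞 K) ∈ v.asIdeal)
    (hvbar : ((p : ℕ) : 𝓞 K) ∈ vbar.asIdeal) (hne : vbar ≠ v) (hκ : κ.IsAnticyclotomic) {γ : absoluteGaloisGroup K}
    {θsub θquot : FramedGaloisRep K (padicCoeffIntegers (∅ : Set (PadicAlgCl p))) 1}
    (hpair : IsResidualPairOver (W.baseChange K) p θsub θquot)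
    (hram : ∃ τ ∈ decomp vbar, unitChar θsub τ ≠ 1) (S₀ : Set (HeightOneSpectrum (𝓞 K)))
    (c : ℕ) (τ : ℕ → absoluteGaloisGroup K)
    (hreps : ∀ x : subgroupH1 κ.kerSubgroup (charModule (∅ : Set (PadicAlgCl p)) θquot),
      (∀ i, i < p ^ c → resOfLe (charModule (∅ : Set (PadicAlgCl p)) θquot)
        (inf_le_left : κ.kerSubgroup ⊓ decomp vbar ≤ κ.kerSubgroup)
        (conjH1 κ.kerSubgroup (charModule (∅ : Set (PadicAlgCl p)) θquot) (τ i) x) = 0) →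
        ∀ σ : absoluteGaloisGroup K, resOfLe (charModule (∅ : Set (PadicAlgCl p)) θquot)
          (inf_le_left : κ.kerSubgroup ⊓ decomp vbar ≤ κ.kerSubgroup)
          (conjH1 κ.kerSubgroup (charModule (∅ : Set (PadicAlgCl p)) θquot) σ x) = 0)
    (DSquot : DatumDualData κ γ (charModule (∅ : Set (PadicAlgCl p)) θquot)
      (AcSelmer.bdpData (charModule (∅ : Set (PadicAlgCl p)) θquot) p vbar) S₀)
    [Module.Finite (IwasawaAlgebra p) DSquot.X] (htor : Module.IsTorsion (IwasawaAlgebra p) DSquot.X)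
    (hμ : muInvariant p DSquot.X = 0) :
    lambdaInvariant p DSquot.X ≤
      zpCorank ↥(grSelmer κ (charModule (∅ : Set (PadicAlgCl p)) θquot) vbar S₀) p + p ^ c := by
  have hp2 : p ≠ 2 := by omega
  exact lambdaInvariant_le_zpCorank_grSelmer_add_pow κ vbar S₀ θquot hvbar c τ hreps
    (fun _ hg x ↦ smul_charModule_quot_eq_of_mem_decomp_of_anomalousTwist W K vbar hp3 hV ha C hC hK hpvK hvbar hne hpair hram hg x)
    (exists_generator_kerSubgroup_inf_decomp_of_isAnticyclotomic κ hK hp2 hκ hvbar) DSquot htor hμ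

/-- **(B1) for the anomalous twist with the cotorsion facts in the `∀ D` form**, instantiated at `DSquot`.
[cite: KellerYin2024, Thm. 1.4.1 (i)–(iii) (arXiv:2402.12781v2 TeX L1087–1098)] -/
theorem lambdaInvariant_le_zpCorank_grSelmer_add_pow_quot_of_anomalousTwist_of_forall
    (hp3 : p = 3) (hV : GoodOrd V p) (ha : (p : ℤ) ∣ V.frobeniusTrace p - 1)
    (C : VariableChange ℚ) (hC : C • V.quadraticTwist ((-1 : ℚ) ^ (p / 2) * p) = W)
    (hK : IsImaginaryQuadratic K) {v vbar : HeightOneSpectrum (𝓞 K)} (hpvK : ((p : ℕ) : 𝓞 K) ∈ v.asIdeal)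
    (hvbar : ((p : ℕ) : 𝓞 K) ∈ vbar.asIdeal) (hne : vbar ≠ v) (hκ : κ.IsAnticyclotomic) {γ : absoluteGaloisGroup K}
    {θsub θquot : FramedGaloisRep K (padicCoeffIntegers (∅ : Set (PadicAlgCl p))) 1}
    (hpair : IsResidualPairOver (W.baseChange K) p θsub θquot)
    (hram : ∃ τ ∈ decomp vbar, unitChar θsub τ ≠ 1) (S₀ : Set (HeightOneSpectrum (𝓞 K)))
    (c : ℕ) (τ : ℕ → absoluteGaloisGroup K)
    (hreps : ∀ x : subgroupH1 κ.kerSubgroup (charModule (∅ : Set (PadicAlgCl p)) θquot),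
      (∀ i, i < p ^ c → resOfLe (charModule (∅ : Set (PadicAlgCl p)) θquot)
        (inf_le_left : κ.kerSubgroup ⊓ decomp vbar ≤ κ.kerSubgroup)
        (conjH1 κ.kerSubgroup (charModule (∅ : Set (PadicAlgCl p)) θquot) (τ i) x) = 0) →
        ∀ σ : absoluteGaloisGroup K, resOfLe (charModule (∅ : Set (PadicAlgCl p)) θquot)
          (inf_le_left : κ.kerSubgroup ⊓ decomp vbar ≤ κ.kerSubgroup)
          (conjH1 κ.kerSubgroup (charModule (∅ : Set (PadicAlgCl p)) θquot) σ x) = 0)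
    (DSquot : DatumDualData κ γ (charModule (∅ : Set (PadicAlgCl p)) θquot)
      (AcSelmer.bdpData (charModule (∅ : Set (PadicAlgCl p)) θquot) p vbar) S₀)
    (hSquot : ∀ D : DatumDualData κ γ (charModule (∅ : Set (PadicAlgCl p)) θquot)
        (AcSelmer.bdpData (charModule (∅ : Set (PadicAlgCl p)) θquot) p vbar) S₀,
      Module.Finite (IwasawaAlgebra p) D.X ∧ Module.IsTorsion (IwasawaAlgebra p) D.X ∧ muInvariant p D.X = 0) :
    lambdaInvariant p DSquot.X ≤
      zpCorank ↥(grSelmer κ (charModule (∅ : Set (PadicAlgCl p)) θquot) vbar S₀) p + p ^ c := by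
  obtain ⟨hfg, htor, hμ⟩ := hSquot DSquot
  haveI := hfg
  exact lambdaInvariant_le_zpCorank_grSelmer_add_pow_quot_of_anomalousTwist W κ hp3 hV ha C hC hK hpvK hvbar hne hκ hpair hram S₀ c
    τ hreps DSquot htor hμ

end QuotBound

/-! ## §3. The `λ`-inequality from the mid-level index identity for the anomalous twist -/

section LambdaLE

/-- **The `λ`-inequality of the V21 index road FOR THE ANOMALOUS `(−3)`-TWIST, orientation `(ω, 𝟙)`, from the mid-level identity.** On
`V/ℚ` globally minimal good ordinary at `p = 3` with `3 ∣ a₃(V) − 1`, `W = C • V^{(p*)}` globally minimal, `K` imaginary quadratic with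
`3 = v v̄`, `κ` anticyclotomic with topological generator `γ`, `(θsub, θquot)` a residual pair of `W_K[3]` with some `τ ∈ D_v̄`, `θsub(τ) ≠ 1`,
`Sf` a finite set of places with `w ∈ Sf ↔ N_W ∈ w` (x1's convention; `9 ∣ N_W`, so it contains `v`, `v̄`, which no Selmer condition of the road
reads), dual data `DSsub`, `DSquot`, representatives `τ i` (`i < 3^c`) for `(F/𝒪)(θquot)` above `v̄`, and the cotorsion facts: the identity
`zpCorank R(W_K[3^∞]) + ε = zpCorank R((F/𝒪)(θsub)) + zpCorank R((F/𝒪)(θquot)) + 3^c` IMPLIES `λ(DSsub.X) + λ(DSquot.X) ≤ λ(𝔛^{Sf}(W_K)) + ε`,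
`ε = [θquot = 𝟙]`.  (C) x1-w5's dictionary; (B2) x2's `lambdaInvariant_eq_zpCorank_grSelmer_of_ramified_of_forall` at the upgraded orientation; (B1)
§2; `omega`. [cite: KellerYin2024, Thm. 1.4.1 (iii) and §1.4 (arXiv:2402.12781v2 TeX L1087–1098, L1240–1260)] [cite: GreenbergLNM1716, §1 p. 60] -/
theorem lambdaInvariant_add_le_of_mid_anomalousTwist {V : WeierstrassCurve ℚ} [V.IsElliptic] [V.IsGloballyMinimal]
    (W : WeierstrassCurve ℚ) [W.IsElliptic] [W.IsGloballyMinimal] (p : ℕ) [Fact p.Prime]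
    (hp3 : p = 3) (hV : GoodOrd V p) (ha : (p : ℤ) ∣ V.frobeniusTrace p - 1)
    (C : VariableChange ℚ) (hC : C • V.quadraticTwist ((-1 : ℚ) ^ (p / 2) * p) = W)
    (K : Type) [Field K] [NumberField K] (hK : IsImaginaryQuadratic K)
    {v : HeightOneSpectrum (𝓞 K)} (vbar : HeightOneSpectrum (𝓞 K)) (hpvK : ((p : ℕ) : 𝓞 K) ∈ v.asIdeal)
    (hvbar : ((p : ℕ) : 𝓞 K) ∈ vbar.asIdeal) (hne : vbar ≠ v)
    (κ : ZpExtension K p) (hκ : κ.IsAnticyclotomic)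
    (γ : absoluteGaloisGroup K) [Fact (κ.IsTopGenerator γ)]
    (θsub θquot : FramedGaloisRep K (padicCoeffIntegers (∅ : Set (PadicAlgCl p))) 1)
    (hpair : IsResidualPairOver (W.baseChange K) p θsub θquot)
    (hram : ∃ τ ∈ decomp vbar, unitChar θsub τ ≠ 1)
    (Sf : Finset (HeightOneSpectrum (𝓞 K)))
    (hSf : ∀ w : HeightOneSpectrum (𝓞 K), w ∈ Sf ↔ ((W.conductorNorm ℤ : ℤ) : 𝓞 K) ∈ w.asIdeal)
    (DSsub : DatumDualData κ γ (charModule ∅ θsub)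
        (AcSelmer.bdpData (charModule ∅ θsub) p vbar) (↑Sf : Set (HeightOneSpectrum (𝓞 K))))
    (DSquot : DatumDualData κ γ (charModule ∅ θquot)
        (AcSelmer.bdpData (charModule ∅ θquot) p vbar) (↑Sf : Set (HeightOneSpectrum (𝓞 K))))
    (c : ℕ) (τ : ℕ → absoluteGaloisGroup K)
    (hreps : ∀ x : subgroupH1 κ.kerSubgroup (charModule ∅ θquot),
      (∀ i, i < p ^ c → resOfLe (charModule ∅ θquot) (inf_le_left : κ.kerSubgroup ⊓ decomp vbar ≤ κ.kerSubgroup)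
        (conjH1 κ.kerSubgroup (charModule ∅ θquot) (τ i) x) = 0) →
        ∀ σ : absoluteGaloisGroup K, resOfLe (charModule ∅ θquot)
          (inf_le_left : κ.kerSubgroup ⊓ decomp vbar ≤ κ.kerSubgroup)
          (conjH1 κ.kerSubgroup (charModule ∅ θquot) σ x) = 0)
    (hmid : zpCorank (datumStrictSelmer κ.kerSubgroup ↥((W.baseChange K).geomPrimaryTorsion p) p
        (AcSelmer.bdpData ↥((W.baseChange K).geomPrimaryTorsion p) p vbar) (↑Sf : Set (HeightOneSpectrum (𝓞 K)))) p +
        (if ∀ σ : absoluteGaloisGroup K, θquot σ = 1 then 1 else 0) =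
      zpCorank (datumStrictSelmer κ.kerSubgroup (charModule ∅ θsub) p (AcSelmer.bdpData (charModule ∅ θsub) p vbar)
          (↑Sf : Set (HeightOneSpectrum (𝓞 K)))) p +
        zpCorank (datumStrictSelmer κ.kerSubgroup (charModule ∅ θquot) p
          (AcSelmer.bdpData (charModule ∅ θquot) p vbar) (↑Sf : Set (HeightOneSpectrum (𝓞 K)))) p + p ^ c)
    [Module.Finite (IwasawaAlgebra p) (AcSelmer.XAc (W.baseChange K) p κ vbar (↑Sf : Set (HeightOneSpectrum (𝓞 K))) γ)]
    (htorS : Module.IsTorsion (IwasawaAlgebra p)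
      (AcSelmer.XAc (W.baseChange K) p κ vbar (↑Sf : Set (HeightOneSpectrum (𝓞 K))) γ))
    (hμS : muInvariant p (AcSelmer.XAc (W.baseChange K) p κ vbar (↑Sf : Set (HeightOneSpectrum (𝓞 K))) γ) = 0)
    (hSsub : ∀ D : DatumDualData κ γ (charModule ∅ θsub)
        (AcSelmer.bdpData (charModule ∅ θsub) p vbar) (↑Sf : Set (HeightOneSpectrum (𝓞 K))),
      Module.Finite (IwasawaAlgebra p) D.X ∧ Module.IsTorsion (IwasawaAlgebra p) D.X ∧ muInvariant p D.X = 0)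
    (hSquot : ∀ D : DatumDualData κ γ (charModule ∅ θquot)
        (AcSelmer.bdpData (charModule ∅ θquot) p vbar) (↑Sf : Set (HeightOneSpectrum (𝓞 K))),
      Module.Finite (IwasawaAlgebra p) D.X ∧ Module.IsTorsion (IwasawaAlgebra p) D.X ∧ muInvariant p D.X = 0) :
    lambdaInvariant p DSsub.X + lambdaInvariant p DSquot.X ≤
      lambdaInvariant p (AcSelmer.XAc (W.baseChange K) p κ vbar (↑Sf : Set (HeightOneSpectrum (𝓞 K))) γ) +
        (if ∀ σ : absoluteGaloisGroup K, θquot σ = 1 then 1 else 0) := by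
  have hθsub : ∀ σ : absoluteGaloisGroup K, θsub σ ^ (p - 1) = 1 := fun σ ↦ (hpair.pow_sub_one σ).1
  have hramI : ∃ τ ∈ inertia vbar, unitChar θsub τ ≠ 1 :=
    exists_mem_inertia_unitChar_ne_one_of_anomalousTwist W K vbar hp3 hV ha C hC hK hpvK hvbar hne hpair hram
  -- (C): `λ(𝔛^{Sf}_f) = zpCorank R(W_K[p^∞])`
  obtain ⟨-, hC'⟩ := IndexPlumbingDictionary.finite_torsionBy_and_lambdaInvariant_XAc_eq_zpCorank_datumStrictSelmer
    W p K vbar κ Sf hK hvbar γ hSf htorS hμS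
  -- (B2): `λ(DSsub.X) = zpCorank R(θsub)`
  have hB2 := SplitMultIndexPlumbing.lambdaInvariant_eq_zpCorank_grSelmer_of_ramified_of_forall κ vbar
    (↑Sf : Set (HeightOneSpectrum (𝓞 K))) θsub hθsub hramI DSsub hSsub
  -- (B1): `λ(DSquot.X) ≤ zpCorank R(θquot) + p^c`
  have hB1 := lambdaInvariant_le_zpCorank_grSelmer_add_pow_quot_of_anomalousTwist_of_forall W κ hp3 hV ha C hC hK hpvK hvbar hne hκ
    hpair hram (↑Sf : Set (HeightOneSpectrum (𝓞 K))) c τ hreps DSquot hSquot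
  change lambdaInvariant p DSsub.X = zpCorank ↥(datumStrictSelmer κ.kerSubgroup (charModule ∅ θsub) p
    (AcSelmer.bdpData (charModule ∅ θsub) p vbar) (↑Sf : Set (HeightOneSpectrum (𝓞 K)))) p at hB2
  change lambdaInvariant p DSquot.X ≤ zpCorank ↥(datumStrictSelmer κ.kerSubgroup (charModule ∅ θquot) p
    (AcSelmer.bdpData (charModule ∅ θquot) p vbar) (↑Sf : Set (HeightOneSpectrum (𝓞 K)))) p + p ^ c at hB1
  omega

end LambdaLE

end Summit.BirchSwinnertonDyer.BirchSwinnertonDyer.Theorems.SchneiderFreeAdditiveX3.AnomalousTwistIndexPlumbing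

end
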